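import Mathlib
import HarnessLib.Audit
import Summits.PneNP.PneNP.Theorems.PstarSliceGenericCriterion

/-!
# Minimally XOR-closed terminal cores have at most one clean chord — unconditionally (ROUND-24, O1/O2; memo g23 §27)

FRONTIER range-avoidance ladder, rung F-N3, ROUND 24 (cell `pnp-ideate`, prover-2 memo `g23/O1-TWOCLEAN-g23.md` §27; typed targets
`PstarCoreBoundTargets.TerminalPeelable` / `TerminalFive` (p646951); restricted-model proof complexity — nothing here bears on `P` versus `NP`).

The clean two-chord theorem (`PstarChordReadTwoClean.false_of_two_clean`) needs `SliceGeneric` at both chords; the criterion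
(`PstarSliceGenericCriterion.sliceGeneric_of_criterion`) derives `SliceGeneric` from `NoPathSumSubcore` (A) and `NoShortCoincidence` (B).  On a
MINIMALLY XOR-CLOSED core `K` — no proper non-empty XOR-closed subfamily, e.g. every core whose XOR multigraph is a single cycle: the triangle of
CONS-T, `C₄`, `C₅`, the centre triangle of a tight twelve-output structure — both are AUTOMATIC for a chord `e` as soon as ANOTHER outside-gated chord
`e'` exists: (A) is vacuous, and in (B) the even family `e + F₁` is XOR-closed, hence all of `K`, so `F₁ = K ∖ e ∋ e'` (Lemma X).  Consequences,
with NO genericity hypothesis: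

* `xorClosed_of_even`, `eq_erase_of_minimal` — the graph facts;
* `sliceGeneric_of_minimal` — on a minimally XOR-closed `K` (menu disjoint, inside the radius), a chord `e` is slice-generic as soon as some other
  member of `K` is an outside-gated chord;
* **`false_of_minimal_two_clean`** — a terminal core whose core is minimally XOR-closed has NO two distinct outside-gated chords;
* `false_of_two_clean_criterion` — the general composition: two distinct outside-gated chords passing the criterion kill (any core).

For the O1 chain (`NoPathSumSubcore`): a path-sum sub-core `K₀ ⊆ J₀ ∖ c` that is a cycle in the XOR graph carries at most one `K₀`-clean chord — so it
needs menu monomials coupling AND variables of two of its members (the σσ′ couplings of memo §26.3).  For O2/TerminalFive: the CONS-T mechanism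
(cross gate on two chords of a triangle, third chord monomial-free) is the only way a triangle can be terminal.  No Assumption A.
-/

set_option linter.dupNamespace false -- `Summit.PneNP.PneNP.…`: summit = sub-problem name (D-0017 single-conjunct layout)

open Finset Literature.Computability.Complexity
open Summit.PneNP.PneNP.Theorems.PstarTyped (Typed)
open Summit.PneNP.PneNP.Theorems.PstarSALevel (varSet bdry BoundaryExpanding SimpleOverlap)
open Summit.PneNP.PneNP.Theorems.PstarXCore (xverts)
open Summit.PneNP.PneNP.Theorems.PstarCoreBound (XorClosed)
open Summit.PneNP.PneNP.Theorems.PstarChordRepair (IsChord)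
open Summit.PneNP.PneNP.Theorems.PstarCoreBoundTargets (Terminal)
open Summit.PneNP.PneNP.Theorems.PstarChordBridgeTools (xpdeg)
open Summit.PneNP.PneNP.Theorems.PstarChordBridgeCotree (mem_xverts_iff_xpdeg_pos)
open Summit.PneNP.PneNP.Theorems.PstarChordBridgeCentre (xorClosed_of_leafless)
open Summit.PneNP.PneNP.Theorems.PstarNorUnitAssembly (xpdeg_singleton_of_mem)
open Summit.PneNP.PneNP.Theorems.PstarXCore (xpair mem_xpair)
open Summit.PneNP.PneNP.Theorems.PstarChordReadLemma (SliceGeneric)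
open Summit.PneNP.PneNP.Theorems.PstarChordReadOutside (OutsideGated)
open Summit.PneNP.PneNP.Theorems.PstarChordReadTwoClean (false_of_two_clean)
open Summit.PneNP.PneNP.Theorems.PstarSliceGenericCriterion (NoPathSumSubcore NoShortCoincidence sliceGeneric_of_criterion)

namespace Summit.PneNP.PneNP.Theorems.PstarMinimalCoreClean

variable {n m : ℕ}

/-- `K` is **MINIMALLY XOR-CLOSED**: its only non-empty XOR-closed subfamily is `K` itself. -/
def MinimalXorClosed (I : LocalMap 4 n m) (K : Finset (Fin m)) : Prop := ∀ S ⊆ K, S.Nonempty → XorClosed I S → S = K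

section Graph

variable (I : LocalMap 4 n m)

/-- A family in which every variable has even XOR slot-degree is XOR-closed. -/
theorem xorClosed_of_even (hI : I.IsPure xorAndPred) {S : Finset (Fin m)} (h : ∀ v, Even (xpdeg I S v)) : XorClosed I S := by
  refine xorClosed_of_leafless I hI fun w hw => ?_
  have hpos := (mem_xverts_iff_xpdeg_pos I S w).1 hw
  obtain ⟨k, hk⟩ := h w
  omega

variable {I}

/-- **In a minimally XOR-closed `K`, an even completion of `e ∈ K` inside `K ∖ e` is all of `K ∖ e`.** -/
theorem eq_erase_of_minimal (hI : I.IsPure xorAndPred) {K F : Finset (Fin m)} (hmin : MinimalXorClosed I K) {e : Fin m} (he : e ∈ K)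
    (hF : F ⊆ K.erase e) (heven : ∀ v, Even (xpdeg I (insert e F) v)) : F = K.erase e := by
  have hsub : insert e F ⊆ K := insert_subset_iff.2 ⟨he, hF.trans (erase_subset e K)⟩
  have hK : insert e F = K := hmin _ hsub ⟨e, mem_insert_self e F⟩ (xorClosed_of_even I hI heven)
  refine Subset.antisymm hF fun f hf => ?_
  obtain ⟨hfe, hfK⟩ := mem_erase.1 hf
  rw [← hK] at hfK
  rcases mem_insert.1 hfK with h | h
  · exact absurd h hfe
  · exact h

end Graph

section Minimal

variable {I : LocalMap 4 n m} {r : ℕ} {y : Fin m → Bool} {K 𝒢 : Finset (Fin m)} {e e' : Fin m}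

/-- Branch (A) is vacuous on a minimally XOR-closed core. -/
theorem noPathSumSubcore_of_minimal (hmin : MinimalXorClosed I K) (he : e ∈ K) : NoPathSumSubcore I r y K e 𝒢 := by
  intro K₀ hK₀ hne hX
  have hK : K₀ = K := hmin K₀ (hK₀.trans (erase_subset e K)) hne hX
  exact absurd (hK ▸ he : e ∈ K₀) (fun h => (mem_erase.1 (hK₀ h)).1 rfl)

/-- Branch (B) reduces to `F₁ = K ∖ e`, which contains the other clean chord. -/
theorem noShortCoincidence_of_minimal (hI : I.IsPure xorAndPred) (hmin : MinimalXorClosed I K) (he : e ∈ K) (he' : e' ∈ K) (hne : e ≠ e')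
    (hch' : IsChord I K e') (hO' : OutsideGated I K 𝒢 e') : NoShortCoincidence I K e 𝒢 := by
  intro F₁ hF₁ _ hclean heven _ _
  have hF : F₁ = K.erase e := eq_erase_of_minimal hI hmin he hF₁ heven
  exact hclean e' (hF ▸ mem_erase.2 ⟨hne.symm, he'⟩) hch' hO'

/-- **On a minimally XOR-closed core, a chord is slice-generic as soon as another member is an outside-gated chord** — no hypothesis on `e` itself
beyond membership. -/
theorem sliceGeneric_of_minimal (hI : I.IsPure xorAndPred) (hT : Typed I) (hS : SimpleOverlap I) (hB : BoundaryExpanding r I)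
    (hmin : MinimalXorClosed I K) (hdisj : Disjoint K 𝒢) (hr : (K ∪ 𝒢).card ≤ r) (he : e ∈ K) (he' : e' ∈ K) (hne : e ≠ e')
    (hch' : IsChord I K e') (hO' : OutsideGated I K 𝒢 e') : SliceGeneric I y K e 𝒢 :=
  sliceGeneric_of_criterion hI hT hS hB he hdisj hr (noPathSumSubcore_of_minimal hmin he)
    (noShortCoincidence_of_minimal hI hmin he he' hne hch' hO')

variable {w₁ w₂ : Finset (Fin n) × Finset (Fin m) × Bool}

/-- **A TERMINAL CORE WHOSE CORE IS MINIMALLY XOR-CLOSED HAS AT MOST ONE OUTSIDE-GATED CHORD** (pure typed `(r,3/2)`-expanding instance with simple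
overlaps; no genericity hypothesis). -/
theorem false_of_minimal_two_clean (hI : I.IsPure xorAndPred) (hT : Typed I) (hS : SimpleOverlap I) (hB : BoundaryExpanding r I)
    (ht : Terminal I r y K w₁ w₂) (hmin : MinimalXorClosed I K) (he : e ∈ K) (he' : e' ∈ K) (hne : e ≠ e') (hch : IsChord I K e)
    (hch' : IsChord I K e') (hO : OutsideGated I K (w₁.2.1 ∪ w₂.2.1) e) (hO' : OutsideGated I K (w₁.2.1 ∪ w₂.2.1) e') : False := by
  have hdisj : Disjoint K (w₁.2.1 ∪ w₂.2.1) := disjoint_union_right.2 ⟨ht.2.2.2.1, ht.2.2.2.2.1⟩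
  have hr : (K ∪ (w₁.2.1 ∪ w₂.2.1)).card ≤ r := by rw [← union_assoc]; exact ht.2.2.2.2.2.1
  exact false_of_two_clean hI hT hS hB ht he he' hne hch hch' hO hO'
    (sliceGeneric_of_minimal hI hT hS hB hmin hdisj hr he he' hne hch' hO')
    (sliceGeneric_of_minimal hI hT hS hB hmin hdisj hr he' he hne.symm hch hO)

end Minimal

section General

variable {I : LocalMap 4 n m} {r : ℕ} {y : Fin m → Bool} {J₀ : Finset (Fin m)} {w₁ w₂ : Finset (Fin n) × Finset (Fin m) × Bool} {cᵢ cⱼ : Fin m}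

/-- **Two distinct outside-gated chords passing the criterion kill** (the clean two-chord theorem composed with the criterion; any core). -/
theorem false_of_two_clean_criterion (hI : I.IsPure xorAndPred) (hT : Typed I) (hS : SimpleOverlap I) (hB : BoundaryExpanding r I)
    (ht : Terminal I r y J₀ w₁ w₂) (hcᵢ : cᵢ ∈ J₀) (hcⱼ : cⱼ ∈ J₀) (hne : cᵢ ≠ cⱼ) (hchᵢ : IsChord I J₀ cᵢ) (hchⱼ : IsChord I J₀ cⱼ)
    (hOᵢ : OutsideGated I J₀ (w₁.2.1 ∪ w₂.2.1) cᵢ) (hOⱼ : OutsideGated I J₀ (w₁.2.1 ∪ w₂.2.1) cⱼ)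
    (hAᵢ : NoPathSumSubcore I r y J₀ cᵢ (w₁.2.1 ∪ w₂.2.1)) (hBᵢ : NoShortCoincidence I J₀ cᵢ (w₁.2.1 ∪ w₂.2.1))
    (hAⱼ : NoPathSumSubcore I r y J₀ cⱼ (w₁.2.1 ∪ w₂.2.1)) (hBⱼ : NoShortCoincidence I J₀ cⱼ (w₁.2.1 ∪ w₂.2.1)) : False := by
  have hdisj : Disjoint J₀ (w₁.2.1 ∪ w₂.2.1) := disjoint_union_right.2 ⟨ht.2.2.2.1, ht.2.2.2.2.1⟩
  have hr : (J₀ ∪ (w₁.2.1 ∪ w₂.2.1)).card ≤ r := by rw [← union_assoc]; exact ht.2.2.2.2.2.1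
  exact false_of_two_clean hI hT hS hB ht hcᵢ hcⱼ hne hchᵢ hchⱼ hOᵢ hOⱼ (sliceGeneric_of_criterion hI hT hS hB hcᵢ hdisj hr hAᵢ hBᵢ)
    (sliceGeneric_of_criterion hI hT hS hB hcⱼ hdisj hr hAⱼ hBⱼ)

end General

end Summit.PneNP.PneNP.Theorems.PstarMinimalCoreClean
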